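import Mathlib
import HarnessLib
import Literature.Geometry.Lorentzian.KillingOpensJetRigidity
import Literature.Geometry.Lorentzian.EinsteinTensorNaturality
import Literature.Geometry.Lorentzian.LeviCivitaProofs
import Literature.Geometry.Lorentzian.IsometryProofs
import Literature.Geometry.Lorentzian.HypersurfaceRestriction

/-!
# Unique continuation of local Killing fields on an abstract manifold (crux
# `NonTrappingHawkingRigidity`, stmt-FinalStateConjecture-13896, line `Sketch`, stub S3 helper)

A LOCAL Killing field of a smooth pseudo-Riemannian metric `g` on a manifold `M` modelled on a
finite-dimensional real normed space `E` — a section `Z` of `TM` which is `C^∞` on an open set `W`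
and satisfies the Killing equation `g(∇_v Z, w) + g(v, ∇_w Z) = 0` at every point of `W` — that
vanishes on a non-empty open subset of a preconnected `W` vanishes on all of `W`
(`killing_eqOn_zero_of_isPreconnected`). O'Neill 1983, Ch. 9, Lemma 9.28 / Kobayashi–Nomizu I,
Ch. VI, Thm. 3.3 (a Killing field is determined by its one-jet at a point), in the open-set form.

Proof. The tree proves the one-jet rigidity for GLOBAL Killing fields of a chart metric on
`U : Opens E` (`OpensChart.IsKillingField.eq_zero_of_oneJet_eq_zero'`, no completeness needed). We
transfer it: for an equidimensional immersion `Ψ : U → M` (`U : Opens E` preconnected) the pulled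
back field `Ψ^* Z` is a global Killing field of the pulled back metric `Ψ^* g`
(`PseudoRiemannianMetric.comap`, naturality of the Killing equation
`val_leviCivita_mpullback_add`), so it vanishes as soon as it vanishes near one point
(`killing_comp_eq_zero_of_eventually`); applied to the inverse of a chart restricted to a ball this
gives the local statement on `M` (`exists_nhds_killing_rigid`), and a clopen argument on the set of
points near which `Z` vanishes concludes. Everything is proved; no definitions.
-/

noncomputable section

-- D-0017: single-problem summit, `Summit.<S>.<S>.…` by design
set_option linter.dupNamespace false

namespace Summit.FinalStateConjecture.FinalStateConjecture.Theorems.NonTrappingHawkingRigidity.AzimuthalPartialAnalyticity.SlabPatching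

open Set Filter Function Bundle TopologicalSpace VectorField Literature.Geometry.Lorentzian
open scoped Manifold ContDiff Topology

variable {E : Type*} [NormedAddCommGroup E] [NormedSpace ℝ E]
  {M : Type*} [TopologicalSpace M] [ChartedSpace E M] [IsManifold 𝓘(ℝ, E) ∞ M]

/-- `mvfderiv` only sees the germ of the function (Mathlib's `Filter.EventuallyEq.mfderiv_eq`);
general manifold version (copied from the lead's skeleton, §2). [folklore] -/
theorem mvfderiv_congr_nhds {H : Type*} [TopologicalSpace H] {I : ModelWithCorners ℝ E H}
    {N : Type*} [TopologicalSpace N] [ChartedSpace H N] {x : N} {f f' : N → ℝ}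
    (h : f =ᶠ[𝓝 x] f') : mvfderiv I f x = mvfderiv I f' x := by
  have h1 : mfderiv I 𝓘(ℝ, ℝ) f x = mfderiv I 𝓘(ℝ, ℝ) f' x := h.mfderiv_eq
  have h2 : f x = f' x := h.eq_of_nhds
  unfold mvfderiv
  rw [h1, h2]

/-- The Koszul functional `K(X, Y, Z)(x)` only sees the germ of its middle argument at `x`
(copied from the lead's skeleton, §2). [folklore] -/
theorem koszulFunctional_congr_nhds {H : Type*} [TopologicalSpace H] {I : ModelWithCorners ℝ E H}
    {N : Type*} [TopologicalSpace N] [ChartedSpace H N] [IsManifold I ∞ N] {n : ℕ∞ω}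
    (g : PseudoRiemannianMetric I n E (TangentSpace I : N → Type _)) {x : N}
    {X Y Y' Z : Π x : N, TangentSpace I x} (h : Y =ᶠ[𝓝 x] Y') :
    g.koszulFunctional X Y Z x = g.koszulFunctional X Y' Z x := by
  unfold PseudoRiemannianMetric.koszulFunctional
  have hx : Y x = Y' x := h.eq_of_nhds
  have h1 : (fun y ↦ g.val y (Y y) (Z y)) =ᶠ[𝓝 x] (fun y ↦ g.val y (Y' y) (Z y)) := by
    filter_upwards [h] with y hy; rw [hy]
  have h3 : (fun y ↦ g.val y (X y) (Y y)) =ᶠ[𝓝 x] (fun y ↦ g.val y (X y) (Y' y)) := by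
    filter_upwards [h] with y hy; rw [hy]
  have h4 : VectorField.mlieBracket I Y Z x = VectorField.mlieBracket I Y' Z x :=
    h.mlieBracket_vectorField_eq EventuallyEq.rfl
  have h6 : VectorField.mlieBracket I X Y x = VectorField.mlieBracket I X Y' x :=
    EventuallyEq.rfl.mlieBracket_vectorField_eq h
  rw [mvfderiv_congr_nhds h1, mvfderiv_congr_nhds h3, h4, h6, hx]

open scoped Classical in
/-- `leviCivitaFun g Y x` only sees the germ of `Y` at `x` (copied from the lead's skeleton, §2).
[folklore] -/
theorem leviCivitaFun_congr_nhds {H : Type*} [TopologicalSpace H] {I : ModelWithCorners ℝ E H}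
    {N : Type*} [TopologicalSpace N] [ChartedSpace H N] [IsManifold I ∞ N] {n : ℕ∞ω}
    (g : PseudoRiemannianMetric I n E (TangentSpace I : N → Type _)) {x : N}
    {Y Y' : Π x : N, TangentSpace I x} (h : Y =ᶠ[𝓝 x] Y') :
    g.leviCivitaFun Y x = g.leviCivitaFun Y' x := by
  have hF : (fun (X₀ Z₀ : TangentSpace I x) ↦
      g.koszulFunctional (FiberBundle.extend E X₀) Y (FiberBundle.extend E Z₀) x) =
      (fun X₀ Z₀ ↦ g.koszulFunctional (FiberBundle.extend E X₀) Y' (FiberBundle.extend E Z₀) x) := by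
    funext X₀ Z₀; exact koszulFunctional_congr_nhds g h
  have key : ∀ (F F' : TangentSpace I x → TangentSpace I x → ℝ), F = F' →
      (dite (∃ A : TangentSpace I x →L[ℝ] TangentSpace I x, ∀ X₀ Z₀, 2 * g.val x (A X₀) Z₀ = F X₀ Z₀)
        (fun h ↦ h.choose) (fun _ ↦ 0)) =
      dite (∃ A : TangentSpace I x →L[ℝ] TangentSpace I x, ∀ X₀ Z₀, 2 * g.val x (A X₀) Z₀ = F' X₀ Z₀)
        (fun h ↦ h.choose) (fun _ ↦ 0) := by
    rintro F F' rfl; rfl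
  unfold PseudoRiemannianMetric.leviCivitaFun
  exact key (fun X₀ Z₀ ↦ g.koszulFunctional (FiberBundle.extend E X₀) Y (FiberBundle.extend E Z₀) x)
    (fun X₀ Z₀ ↦ g.koszulFunctional (FiberBundle.extend E X₀) Y' (FiberBundle.extend E Z₀) x) hF

/-- **Locality of the Levi-Civita connection**: `∇Y(x)` depends only on the germ of `Y` at `x`
(copied from the lead's skeleton, §2). O'Neill 1983, Ch. 3, Thm. 3.11. [cite: ONeill1983, Ch. 3, Thm. 3.11] -/
theorem leviCivita_congr_nhds {H : Type*} [TopologicalSpace H] {I : ModelWithCorners ℝ E H}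
    {N : Type*} [TopologicalSpace N] [ChartedSpace H N] [IsManifold I ∞ N] {n : ℕ∞ω}
    (g : PseudoRiemannianMetric I n E (TangentSpace I : N → Type _)) [Fact (1 ≤ n)]
    [FiniteDimensional ℝ E] [CompleteSpace E] [g.HasLeviCivita] {x : N}
    {Y Y' : Π x : N, TangentSpace I x} (h : Y =ᶠ[𝓝 x] Y') :
    g.leviCivita Y x = g.leviCivita Y' x := by
  rw [PseudoRiemannianMetric.leviCivita_apply, PseudoRiemannianMetric.leviCivita_apply]
  exact leviCivitaFun_congr_nhds g h

variable [FiniteDimensional ℝ E] [CompleteSpace E]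
  (g : PseudoRiemannianMetric 𝓘(ℝ, E) ∞ E (TangentSpace 𝓘(ℝ, E) : M → Type _)) [g.HasLeviCivita]

/-- **One-jet rigidity through an equidimensional immersion from a preconnected chart domain.**
Let `Ψ : U → M` (`U : Opens E` preconnected) be `C^∞` with injective differentials, and `Z` a
section of `TM` which is `C^∞` and satisfies the Killing equation at every point `Ψ u`. If `Z ∘ Ψ`
vanishes near one point of `U`, it vanishes on all of `U`: the pullback `Ψ^* Z` is a Killing field
of `Ψ^* g` on `U` (`val_leviCivita_mpullback_add`) with vanishing one-jet at that point, so the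
tree's `OpensChart.IsKillingField.eq_zero_of_oneJet_eq_zero'` applies. O'Neill 1983, Ch. 9,
Lemma 9.28. [cite: ONeill1983, Ch. 9, Lemma 9.28] -/
theorem killing_comp_eq_zero_of_eventually {U : Opens E} (hUc : IsPreconnected (U : Set E))
    (Ψ : U → M) (hΨ : ContMDiff 𝓘(ℝ, E) 𝓘(ℝ, E) (∞ + 1) Ψ)
    (hΨ' : ∀ u, Function.Injective (mfderiv 𝓘(ℝ, E) 𝓘(ℝ, E) Ψ u))
    {Z : Π x : M, TangentSpace 𝓘(ℝ, E) x}
    (hZs : ∀ u : U, ContMDiffAt 𝓘(ℝ, E) (𝓘(ℝ, E).prod 𝓘(ℝ, E)) ∞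
      (fun x ↦ (TotalSpace.mk' E x (Z x) : TangentBundle 𝓘(ℝ, E) M)) (Ψ u))
    (hZk : ∀ u : U, ∀ v w : TangentSpace 𝓘(ℝ, E) (Ψ u),
      g.val (Ψ u) (g.leviCivita Z (Ψ u) v) w + g.val (Ψ u) v (g.leviCivita Z (Ψ u) w) = 0)
    {u₀ : U} (h0 : ∀ᶠ u in 𝓝 u₀, Z (Ψ u) = 0) : ∀ u : U, Z (Ψ u) = 0 := by
  have hdim : Module.finrank ℝ E = Module.finrank ℝ E := rfl
  have hpb : PseudoRiemannianMetric.contMDiff_pullbackBilin 𝓘(ℝ, E) M 𝓘(ℝ, E) U ∞ :=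
    PseudoRiemannianMetric.contMDiff_pullbackBilin_holds
  haveI := (g.comap hpb Ψ hΨ hΨ' hdim).hasLeviCivita
  have hinv : ∀ u, (mfderiv 𝓘(ℝ, E) 𝓘(ℝ, E) Ψ u).IsInvertible := fun u ↦
    PseudoRiemannianMetric.isInvertible_mfderiv_of_injective hdim (hΨ' u)
  -- `Ψ^* Z` is a Killing field of `Ψ^* g`
  have hZ'K : (g.comap hpb Ψ hΨ hΨ' hdim).IsKillingField (mpullback 𝓘(ℝ, E) 𝓘(ℝ, E) Ψ Z) := by
    refine ⟨fun u ↦ ?_, fun u Y₀ W₀ ↦ ?_⟩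
    · exact ContMDiffAt.mpullback_vectorField_preimage (hZs u) (hΨ u) (hinv u) le_rfl
    · have hZd : MDiffAt (T% Z) (Ψ u) := (hZs u).mdifferentiableAt (by simp)
      rw [g.val_leviCivita_mpullback_add hpb hΨ hΨ' hdim hZd Y₀ W₀]
      exact hZk u _ _
  -- its one-jet vanishes at `u₀`
  have hev : mpullback 𝓘(ℝ, E) 𝓘(ℝ, E) Ψ Z =ᶠ[𝓝 u₀] (0 : Π u : U, TangentSpace 𝓘(ℝ, E) u) := by
    filter_upwards [h0] with u hu
    simp only [mpullback_apply, hu, map_zero, Pi.zero_apply]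
  have h0' : mpullback 𝓘(ℝ, E) 𝓘(ℝ, E) Ψ Z u₀ = 0 := hev.eq_of_nhds
  have h1' : ∀ v : E, (g.comap hpb Ψ hΨ hΨ' hdim).leviCivita (mpullback 𝓘(ℝ, E) 𝓘(ℝ, E) Ψ Z) u₀ v
      = 0 := by
    intro v
    rw [leviCivita_congr_nhds _ hev, (g.comap hpb Ψ hΨ hΨ' hdim).leviCivita.zero]
    rfl
  have hall := PseudoRiemannianMetric.IsKillingField.eq_zero_of_oneJet_eq_zero' hUc hZ'K h0' h1'
  intro u
  have h := PseudoRiemannianMetric.mfderiv_mpullback_apply hΨ' hdim Z u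
  rw [← h, hall u, map_zero]

/-- **Local one-jet rigidity on an abstract manifold.** Every point `x` of `M` has, inside any
given neighbourhood, an open preconnected neighbourhood `B` (the inverse image of a coordinate
ball) on which local Killing fields are rigid: a section `C^∞` on `B` satisfying the Killing
equation on `B` which vanishes near one point of `B` vanishes on `B`
(`killing_comp_eq_zero_of_eventually` for the inverse chart on the ball). O'Neill 1983, Ch. 9,
Lemma 9.28. [cite: ONeill1983, Ch. 9, Lemma 9.28] -/
theorem exists_nhds_killing_rigid (x : M) {V : Set M} (hV : V ∈ 𝓝 x) :
    ∃ B : Set M, IsOpen B ∧ x ∈ B ∧ B ⊆ V ∧ IsPreconnected B ∧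
      ∀ Z : Π x : M, TangentSpace 𝓘(ℝ, E) x,
        ContMDiffOn 𝓘(ℝ, E) (𝓘(ℝ, E).prod 𝓘(ℝ, E)) ∞
          (fun x ↦ (TotalSpace.mk' E x (Z x) : TangentBundle 𝓘(ℝ, E) M)) B →
        (∀ y ∈ B, ∀ v w : TangentSpace 𝓘(ℝ, E) y,
          g.val y (g.leviCivita Z y v) w + g.val y v (g.leviCivita Z y w) = 0) →
        ∀ x₀ ∈ B, (∀ᶠ y in 𝓝 x₀, Z y = 0) → ∀ y ∈ B, Z y = 0 := by
  set φ := chartAt E x with hφ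
  have hxφ : x ∈ φ.source := mem_chart_source E x
  -- a coordinate ball inside `φ.target` whose inverse image lies in `V`
  set O : Set E := φ.target ∩ φ.symm ⁻¹' (interior V ∩ φ.source) with hO
  have hOo : IsOpen O := φ.isOpen_inter_preimage_symm (isOpen_interior.inter φ.open_source)
  have hxO : φ x ∈ O := by
    refine ⟨φ.map_source hxφ, ?_⟩
    show φ.symm (φ x) ∈ interior V ∩ φ.source
    rw [φ.left_inv hxφ]
    exact ⟨mem_interior_iff_mem_nhds.2 hV, hxφ⟩
  obtain ⟨r, hr, hball⟩ := Metric.isOpen_iff.1 hOo (φ x) hxO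
  have hbt : Metric.ball (φ x) r ⊆ φ.target := fun q hq ↦ (hball hq).1
  set B : Set M := φ.source ∩ φ ⁻¹' Metric.ball (φ x) r with hB
  have hBo : IsOpen B := φ.isOpen_inter_preimage Metric.isOpen_ball
  have hxB : x ∈ B := ⟨hxφ, Metric.mem_ball_self hr⟩
  have hBV : B ⊆ V := by
    rintro y ⟨hy, hyb⟩
    have h := (hball hyb).2
    simp only [mem_preimage, φ.left_inv hy] at h
    exact interior_subset h.1
  have hBeq : B = φ.symm '' Metric.ball (φ x) r :=
    (φ.symm_image_eq_source_inter_preimage hbt).symm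
  have hBc : IsPreconnected B := by
    rw [hBeq]
    exact (convex_ball (φ x) r).isPreconnected.image _ (φ.continuousOn_symm.mono hbt)
  refine ⟨B, hBo, hxB, hBV, hBc, fun Z hZs hZk x₀ hx₀ h0 y hy ↦ ?_⟩
  -- the inverse chart on the ball as an equidimensional immersion `Ψ : U → M`
  set U : Opens E := ⟨Metric.ball (φ x) r, Metric.isOpen_ball⟩ with hU
  set Ψ : U → M := fun u ↦ φ.symm u with hΨdef
  have hφatlas : φ ∈ IsManifold.maximalAtlas 𝓘(ℝ, E) ∞ M := IsManifold.chart_mem_maximalAtlas x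
  have hΨ : ContMDiff 𝓘(ℝ, E) 𝓘(ℝ, E) (∞ + 1) Ψ := by
    have h : ((∞ : ℕ∞ω) + 1) = ∞ := rfl
    rw [h]
    exact (contMDiffOn_symm_of_mem_maximalAtlas hφatlas).comp_contMDiff contMDiff_subtype_val
      fun u ↦ hbt u.2
  have hφd : φ.MDifferentiable 𝓘(ℝ, E) 𝓘(ℝ, E) := mdifferentiable_chart x
  have hΨ' : ∀ u, Function.Injective (mfderiv 𝓘(ℝ, E) 𝓘(ℝ, E) Ψ u) := by
    intro u
    have h : mfderiv 𝓘(ℝ, E) 𝓘(ℝ, E) Ψ u = mfderiv 𝓘(ℝ, E) 𝓘(ℝ, E) φ.symm (u : E) :=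
      mfderiv_comp_subtypeVal (W := U) (f := φ.symm) (hφd.symm.mdifferentiableAt (hbt u.2))
    rw [h]
    exact hφd.symm.mfderiv_injective (hbt u.2)
  have hΨB : ∀ u : U, Ψ u ∈ B := fun u ↦ by
    rw [hBeq]; exact mem_image_of_mem _ u.2
  have hUc : IsPreconnected (U : Set E) := (convex_ball (φ x) r).isPreconnected
  have hZs' : ∀ u : U, ContMDiffAt 𝓘(ℝ, E) (𝓘(ℝ, E).prod 𝓘(ℝ, E)) ∞
      (fun x ↦ (TotalSpace.mk' E x (Z x) : TangentBundle 𝓘(ℝ, E) M)) (Ψ u) := fun u ↦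
    (hZs _ (hΨB u)).contMDiffAt (hBo.mem_nhds (hΨB u))
  have hZk' : ∀ u : U, ∀ v w : TangentSpace 𝓘(ℝ, E) (Ψ u),
      g.val (Ψ u) (g.leviCivita Z (Ψ u) v) w + g.val (Ψ u) v (g.leviCivita Z (Ψ u) w) = 0 :=
    fun u ↦ hZk _ (hΨB u)
  -- the vanishing germ at `x₀`, read at `u₀ = φ x₀`
  set u₀ : U := ⟨φ x₀, hx₀.2⟩ with hu₀
  have hΨu₀ : Ψ u₀ = x₀ := φ.left_inv hx₀.1
  have h0' : ∀ᶠ u in 𝓝 u₀, Z (Ψ u) = 0 := by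
    have hc : Tendsto Ψ (𝓝 u₀) (𝓝 (Ψ u₀)) := hΨ.continuous.continuousAt
    rw [hΨu₀] at hc
    exact hc.eventually h0
  have hall := killing_comp_eq_zero_of_eventually g hUc Ψ hΨ hΨ' hZs' hZk' h0'
  have hyu : Ψ ⟨φ y, hy.2⟩ = y := φ.left_inv hy.1
  have h := hall ⟨φ y, hy.2⟩
  rw [hyu] at h
  exact h

/-- **Unique continuation of local Killing fields** (open-set form of the one-jet rigidity,
O'Neill 1983, Ch. 9, Lemma 9.28; Kobayashi–Nomizu I, Ch. VI, Thm. 3.3): a section of `TM` which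
is `C^∞` on an open preconnected set `W`, satisfies the Killing equation
`g(∇_v Z, w) + g(v, ∇_w Z) = 0` at every point of `W`, and vanishes on a non-empty open subset
`O ⊆ W`, vanishes on `W`. Proof: the set of points of `W` near which `Z` vanishes is open,
non-empty and — by the local rigidity `exists_nhds_killing_rigid` — closed in `W`.
[cite: ONeill1983, Ch. 9, Lemma 9.28] -/
theorem killing_eqOn_zero_of_isPreconnected {W O : Set M} (hW : IsOpen W)
    (hWc : IsPreconnected W) {Z : Π x : M, TangentSpace 𝓘(ℝ, E) x}
    (hZs : ContMDiffOn 𝓘(ℝ, E) (𝓘(ℝ, E).prod 𝓘(ℝ, E)) ∞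
      (fun x ↦ (TotalSpace.mk' E x (Z x) : TangentBundle 𝓘(ℝ, E) M)) W)
    (hZk : ∀ x ∈ W, ∀ v w : TangentSpace 𝓘(ℝ, E) x,
      g.val x (g.leviCivita Z x v) w + g.val x v (g.leviCivita Z x w) = 0)
    (hO : IsOpen O) (hOW : O ⊆ W) (hOne : O.Nonempty) (hZO : ∀ x ∈ O, Z x = 0) :
    ∀ x ∈ W, Z x = 0 := by
  -- the set of points near which `Z` vanishes
  set S : Set M := {x | ∀ᶠ y in 𝓝 x, Z y = 0} with hS
  have hSo : IsOpen S := by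
    simp only [hS, isOpen_iff_mem_nhds, mem_setOf_eq]
    exact fun x hx ↦ hx.eventually_nhds
  have hOS : O ⊆ S := fun x hx ↦ Filter.eventually_of_mem (hO.mem_nhds hx) hZO
  have hne : (W ∩ S).Nonempty := by
    obtain ⟨x, hx⟩ := hOne
    exact ⟨x, hOW hx, hOS hx⟩
  -- closed in `W`
  have hcl : closure S ∩ W ⊆ S := by
    rintro x ⟨hxc, hxW⟩
    obtain ⟨B, hBo, hxB, hBW, -, hrig⟩ := exists_nhds_killing_rigid g x (hW.mem_nhds hxW)
    obtain ⟨y, hyB, hyS⟩ : (B ∩ S).Nonempty := mem_closure_iff.1 hxc B hBo hxB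
    have hB0 := hrig Z (hZs.mono hBW) (fun y hy ↦ hZk y (hBW hy)) y hyB hyS
    exact Filter.eventually_of_mem (hBo.mem_nhds hxB) hB0
  have hWS : W ⊆ S := hWc.subset_of_closure_inter_subset hSo hne hcl
  intro x hx
  have h : ∀ᶠ y in 𝓝 x, Z y = 0 := hWS hx
  exact h.self_of_nhds

/-- **Registered form (sub-goal `stub_slabPatching_killingUC` of stub S3 `stub_slabPatching`):
unique continuation of local Killing fields on the carrier of a stationary black hole** — the
specialisation of `killing_eqOn_zero_of_isPreconnected` to `𝓑.carrier`, `𝓑.metric`, in the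
vocabulary of the registered stubs. [cite: ONeill1983, Ch. 9, Lemma 9.28] -/
theorem stub_slabPatching_killingUC :
    ∀ (𝓑 : StationaryAFBlackHole.{0}) [𝓑.metric.HasLeviCivita],
      ∀ (W O : Set 𝓑.carrier) (Z : Π x : 𝓑.carrier, TangentSpace (𝓡 4) x),
      IsOpen W → IsPreconnected W →
      ContMDiffOn (𝓡 4) ((𝓡 4).prod 𝓘(ℝ, E4)) ((⊤ : ℕ∞) : WithTop ℕ∞)
        (fun x ↦ (Bundle.TotalSpace.mk' E4 x (Z x) : TangentBundle (𝓡 4) 𝓑.carrier)) W →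
      (∀ x ∈ W, ∀ v w : TangentSpace (𝓡 4) x,
        𝓑.metric.val x (𝓑.metric.leviCivita Z x v) w + 𝓑.metric.val x v (𝓑.metric.leviCivita Z x w) = 0) →
      IsOpen O → O ⊆ W → O.Nonempty → (∀ x ∈ O, Z x = 0) → ∀ x ∈ W, Z x = 0 := by
  intro 𝓑 _ W O Z hW hWc hZs hZk hO hOW hOne hZO
  exact killing_eqOn_zero_of_isPreconnected 𝓑.metric.toPseudoRiemannianMetric hW hWc hZs hZk hO
    hOW hOne hZO

end Summit.FinalStateConjecture.FinalStateConjecture.Theorems.NonTrappingHawkingRigidity.AzimuthalPartialAnalyticity.SlabPatching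

end
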